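import Mathlib.LinearAlgebra.BilinearForm.Orthogonal
import Mathlib.LinearAlgebra.FiniteDimensional.Lemmas
import Mathlib.RingTheory.Noetherian.Basic
import Mathlib.Algebra.Field.ZMod

/-!
# Crux `CubicForrelation.NearExactIsExact` (stmt-QuantumAdvantage-14043), line `direct-sum-amplification` —
stub PENCIL SPLIT: an invariant Lagrangian for a commuting square-zero self-adjoint family

Setting: `V` a finite-dimensional `𝔽₂`-space, `B` an alternating bilinear form on `V` (no nondegeneracy is
assumed), `Ys` a set of endomorphisms that are `B`-self-adjoint (`B (Y v) w = B v (Y w)`), pairwise commuting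
and square-zero (`Y (Y v) = 0`). Conclusion (`ps_pencil_split`): there is a submodule `L` which is
`Ys`-invariant, `B`-isotropic and `B`-coisotropic (`L^⊥ ⊆ L`), i.e. an invariant Lagrangian. This is the
splitting lemma for affine pencils of alternating forms `B_u = B (1 + Y_u)` with an affine inverse.

Proof. Call a submodule *good* if it is `Ys`-invariant and isotropic. `⊥` is good and `V` is Noetherian, so
there is a maximal good `N` (`ps_exists_maximal`). If `v₀ ∈ N^⊥ ∖ N`, the left orthogonal `K = N^⊥` is a
`Ys`-invariant submodule (self-adjointness) with `N < K`. The purely linear-algebraic common-kernel lemma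
`ps_common_kernel_vector` (commuting square-zero operators acting on `K/N ≠ 0` have a common nonzero kernel
vector; induction on `finrank K`, shrinking `K` to `K ⊓ Y₁⁻¹ N`) yields `v ∈ K ∖ N` with `Y v ∈ N` for all
`Y ∈ Ys`; then `N ⊔ 𝔽₂ v` is good (isotropic because `v ∈ N^⊥`, `B` is skew and `B v v = 0`) and strictly
larger than `N`, contradicting maximality. Everything is proved from Mathlib; axioms are the standard three.
-/

set_option linter.dupNamespace false -- D-0017: single-problem summit ⇒ `QuantumAdvantage.QuantumAdvantage` by design

namespace Summit.QuantumAdvantage.QuantumAdvantage.Theorems.CubicForrelation.NearExactIsExact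

/-- A finite `𝔽₂`-module is Noetherian, so every property of submodules that holds for `⊥` has a maximal
witness. [folklore] -/
theorem ps_exists_maximal {V : Type*} [AddCommGroup V] [Module (ZMod 2) V] [Module.Finite (ZMod 2) V]
    (P : Submodule (ZMod 2) V → Prop) (h0 : P ⊥) :
    ∃ N, P N ∧ ∀ N', P N' → ¬ N < N' := by
  obtain ⟨N, hN, hmax⟩ :=
    set_has_maximal_iff_noetherian.mpr (inferInstance : IsNoetherian (ZMod 2) V) {N | P N} ⟨⊥, h0⟩
  exact ⟨N, hN, hmax⟩

/-- Common-kernel lemma: if `Ys` is a pairwise commuting family of square-zero endomorphisms, `N` is a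
`Ys`-invariant submodule and `K` is a `Ys`-invariant submodule with `N < K`, then some `v ∈ K ∖ N` is mapped
into `N` by every `Y ∈ Ys` (a common kernel vector of the induced nilpotent family on `K/N`). Induction on
`finrank K`: either every `Y` maps `K` into `N`, or `K ⊓ Y₁⁻¹ N` is a smaller invariant submodule still
strictly containing `N` (it contains `Y₁ w ∉ N`). [folklore] -/
theorem ps_common_kernel_vector
    {V : Type*} [AddCommGroup V] [Module (ZMod 2) V] [Module.Finite (ZMod 2) V]
    (Ys : Set (V →ₗ[ZMod 2] V))
    (hcomm : ∀ Y ∈ Ys, ∀ Y' ∈ Ys, ∀ v, Y (Y' v) = Y' (Y v))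
    (hsq : ∀ Y ∈ Ys, ∀ v, Y (Y v) = 0)
    (N : Submodule (ZMod 2) V) (hN : ∀ Y ∈ Ys, ∀ v ∈ N, Y v ∈ N) :
    ∀ (k : ℕ) (K : Submodule (ZMod 2) V), Module.finrank (ZMod 2) K ≤ k → N < K →
      (∀ Y ∈ Ys, ∀ v ∈ K, Y v ∈ K) → ∃ v ∈ K, v ∉ N ∧ ∀ Y ∈ Ys, Y v ∈ N := by
  intro k
  induction k with
  | zero =>
    intro K hk hNK _
    have := Submodule.finrank_lt_finrank_of_lt (bot_le.trans_lt hNK)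
    omega
  | succ k ih =>
    intro K hk hNK hK
    by_cases hall : ∀ Y ∈ Ys, ∀ v ∈ K, Y v ∈ N
    · obtain ⟨v, hvK, hvN⟩ := SetLike.exists_of_lt hNK
      exact ⟨v, hvK, hvN, fun Y hY => hall Y hY v hvK⟩
    · push Not at hall
      obtain ⟨Y₁, hY₁, w, hwK, hw⟩ := hall
      -- the smaller invariant submodule `K' = {v ∈ K | Y₁ v ∈ N}`
      have hK'K : K ⊓ N.comap Y₁ < K := by
        rw [SetLike.lt_iff_le_and_exists]
        exact ⟨inf_le_left, w, hwK, fun h => hw (Submodule.mem_comap.mp (Submodule.mem_inf.mp h).2)⟩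
      have hNK' : N < K ⊓ N.comap Y₁ := by
        rw [SetLike.lt_iff_le_and_exists]
        refine ⟨le_inf hNK.le fun v hv => Submodule.mem_comap.mpr (hN Y₁ hY₁ v hv), Y₁ w, ?_, hw⟩
        refine Submodule.mem_inf.mpr ⟨hK Y₁ hY₁ w hwK, ?_⟩
        rw [Submodule.mem_comap, hsq Y₁ hY₁ w]
        exact N.zero_mem
      have hK'inv : ∀ Y ∈ Ys, ∀ v ∈ K ⊓ N.comap Y₁, Y v ∈ K ⊓ N.comap Y₁ := by
        intro Y hY v hv
        obtain ⟨hvK, hvN⟩ := Submodule.mem_inf.mp hv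
        rw [Submodule.mem_comap] at hvN
        refine Submodule.mem_inf.mpr ⟨hK Y hY v hvK, ?_⟩
        rw [Submodule.mem_comap]
        show Y₁ (Y v) ∈ N
        rw [hcomm Y₁ hY₁ Y hY v]
        exact hN Y hY _ hvN
      have hfin : Module.finrank (ZMod 2) ↥(K ⊓ N.comap Y₁) ≤ k := by
        have := Submodule.finrank_lt_finrank_of_lt hK'K
        omega
      obtain ⟨v, hvK', hvN, hvY⟩ := ih (K ⊓ N.comap Y₁) hfin hNK' hK'inv
      exact ⟨v, (Submodule.mem_inf.mp hvK').1, hvN, hvY⟩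

/-- **Pencil splitting lemma.** For an alternating bilinear form `B` on a finite `𝔽₂`-space and a set `Ys`
of `B`-self-adjoint, pairwise commuting, square-zero endomorphisms, there is a `Ys`-invariant submodule `L`
that is `B`-isotropic and contains its own (left) orthogonal: an invariant Lagrangian. (The hypothesis
`B (Y v) v = 0` is part of the pencil set-up but is not needed for this conclusion.) [new] -/
theorem ps_pencil_split :
    ∀ {V : Type*} [AddCommGroup V] [Module (ZMod 2) V] [Module.Finite (ZMod 2) V]
      (B : LinearMap.BilinForm (ZMod 2) V) (Ys : Set (V →ₗ[ZMod 2] V)),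
      (∀ v, B v v = 0) →
      (∀ Y ∈ Ys, ∀ v w, B (Y v) w = B v (Y w)) →
      (∀ Y ∈ Ys, ∀ v, B (Y v) v = 0) →
      (∀ Y ∈ Ys, ∀ Y' ∈ Ys, ∀ v, Y (Y' v) = Y' (Y v)) →
      (∀ Y ∈ Ys, ∀ v, Y (Y v) = 0) →
      ∃ L : Submodule (ZMod 2) V, (∀ Y ∈ Ys, ∀ v ∈ L, Y v ∈ L) ∧ (∀ v ∈ L, ∀ w ∈ L, B v w = 0) ∧
        ∀ v, (∀ w ∈ L, B v w = 0) → v ∈ L := by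
  intro V _ _ _ B Ys halt hsa _ hcomm hsq
  -- `B` is alternating, hence reflexive: `B x y = 0 → B y x = 0`
  have hBalt : LinearMap.IsAlt B := halt
  have hskew : ∀ x y, B x y = 0 → B y x = 0 := fun x y h => hBalt.eq_iff.mp h
  -- a maximal good (= invariant and isotropic) submodule
  obtain ⟨N, ⟨hNinv, hNiso⟩, hNmax⟩ := ps_exists_maximal
    (fun N : Submodule (ZMod 2) V => (∀ Y ∈ Ys, ∀ v ∈ N, Y v ∈ N) ∧ (∀ v ∈ N, ∀ w ∈ N, B v w = 0))
    ⟨fun Y _ v hv => by rw [(Submodule.mem_bot (ZMod 2)).mp hv, map_zero]; exact Submodule.zero_mem _,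
      fun v hv w _ => by rw [(Submodule.mem_bot (ZMod 2)).mp hv, map_zero, LinearMap.zero_apply]⟩
  refine ⟨N, hNinv, hNiso, ?_⟩
  intro v₀ hv₀
  by_contra hv₀N
  -- the left orthogonal `K = {v | ∀ w ∈ N, B v w = 0}` of `N`
  have hmemK : ∀ v, v ∈ LinearMap.BilinForm.orthogonal B.flip N ↔ ∀ w ∈ N, B v w = 0 :=
    fun v => Iff.rfl
  have hKinv : ∀ Y ∈ Ys, ∀ v ∈ LinearMap.BilinForm.orthogonal B.flip N,
      Y v ∈ LinearMap.BilinForm.orthogonal B.flip N := by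
    intro Y hY v hv
    rw [hmemK] at hv ⊢
    intro w hw
    rw [hsa Y hY v w]
    exact hv _ (hNinv Y hY w hw)
  have hNK : N < LinearMap.BilinForm.orthogonal B.flip N := by
    rw [SetLike.lt_iff_le_and_exists]
    exact ⟨fun n hn => (hmemK n).mpr fun w hw => hNiso n hn w hw, v₀, (hmemK v₀).mpr hv₀, hv₀N⟩
  -- a common kernel vector `v ∈ K ∖ N` of the family acting on `K/N`
  obtain ⟨v, hvK, hvN, hvY⟩ := ps_common_kernel_vector Ys hcomm hsq N hNinv
    (Module.finrank (ZMod 2) ↥(LinearMap.BilinForm.orthogonal B.flip N))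
    (LinearMap.BilinForm.orthogonal B.flip N) le_rfl hNK hKinv
  rw [hmemK] at hvK
  -- `N ⊔ 𝔽₂ v` is good and strictly larger than `N`: contradiction
  refine hNmax (N ⊔ (ZMod 2) ∙ v) ⟨?_, ?_⟩ ?_
  · intro Y hY x hx
    obtain ⟨n, hn, z, hz, rfl⟩ := Submodule.mem_sup.mp hx
    obtain ⟨c, rfl⟩ := Submodule.mem_span_singleton.mp hz
    rw [map_add, map_smul]
    exact Submodule.mem_sup_left (N.add_mem (hNinv Y hY n hn) (N.smul_mem c (hvY Y hY)))
  · intro x hx y hy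
    obtain ⟨n, hn, z, hz, rfl⟩ := Submodule.mem_sup.mp hx
    obtain ⟨c, rfl⟩ := Submodule.mem_span_singleton.mp hz
    obtain ⟨m, hm, z', hz', rfl⟩ := Submodule.mem_sup.mp hy
    obtain ⟨d, rfl⟩ := Submodule.mem_span_singleton.mp hz'
    have h1 : B n v = 0 := hskew v n (hvK n hn)
    simp only [map_add, map_smul, LinearMap.add_apply, LinearMap.smul_apply, smul_eq_mul,
      hNiso n hn m hm, hvK m hm, h1, halt v, mul_zero, add_zero]
  · rw [SetLike.lt_iff_le_and_exists]
    exact ⟨le_sup_left, v, Submodule.mem_sup_right (Submodule.mem_span_singleton_self v), hvN⟩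

/-- Dimension count for the Lagrangian: if the alternating form `B` is moreover nondegenerate, a submodule `L`
that is isotropic and contains its left orthogonal equals `B.orthogonal L`, hence
`2 · finrank L = finrank V` (`LinearMap.BilinForm.finrank_orthogonal`). [folklore] -/
theorem ps_lagrangian_finrank
    {V : Type*} [AddCommGroup V] [Module (ZMod 2) V] [Module.Finite (ZMod 2) V]
    (B : LinearMap.BilinForm (ZMod 2) V) (hB : B.Nondegenerate) (halt : ∀ v, B v v = 0)
    (L : Submodule (ZMod 2) V) (hiso : ∀ v ∈ L, ∀ w ∈ L, B v w = 0)
    (hco : ∀ v, (∀ w ∈ L, B v w = 0) → v ∈ L) :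
    2 * Module.finrank (ZMod 2) L = Module.finrank (ZMod 2) V := by
  have hrefl : LinearMap.IsRefl B := (show LinearMap.IsAlt B from halt).isRefl
  have hL : B.orthogonal L = L := by
    apply le_antisymm
    · intro v hv
      rw [LinearMap.BilinForm.mem_orthogonal_iff] at hv
      exact hco v fun w hw => hrefl _ _ (hv w hw)
    · intro v hv
      rw [LinearMap.BilinForm.mem_orthogonal_iff]
      exact fun n hn => hiso n hn v hv
  have h1 := LinearMap.BilinForm.finrank_orthogonal hB L
  rw [hL] at h1
  have h2 : Module.finrank (ZMod 2) L ≤ Module.finrank (ZMod 2) V := Submodule.finrank_le L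
  omega

/-- **Pencil splitting lemma, nondegenerate case.** Under the hypotheses of `ps_pencil_split` and
nondegeneracy of `B`, the invariant Lagrangian `L` has `2 · finrank L = finrank V`. [new] -/
theorem ps_pencil_split_finrank
    {V : Type*} [AddCommGroup V] [Module (ZMod 2) V] [Module.Finite (ZMod 2) V]
    (B : LinearMap.BilinForm (ZMod 2) V) (Ys : Set (V →ₗ[ZMod 2] V)) (hB : B.Nondegenerate)
    (halt : ∀ v, B v v = 0) (hsa : ∀ Y ∈ Ys, ∀ v w, B (Y v) w = B v (Y w))
    (hYalt : ∀ Y ∈ Ys, ∀ v, B (Y v) v = 0)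
    (hcomm : ∀ Y ∈ Ys, ∀ Y' ∈ Ys, ∀ v, Y (Y' v) = Y' (Y v)) (hsq : ∀ Y ∈ Ys, ∀ v, Y (Y v) = 0) :
    ∃ L : Submodule (ZMod 2) V, (∀ Y ∈ Ys, ∀ v ∈ L, Y v ∈ L) ∧ (∀ v ∈ L, ∀ w ∈ L, B v w = 0) ∧
      (∀ v, (∀ w ∈ L, B v w = 0) → v ∈ L) ∧ 2 * Module.finrank (ZMod 2) L = Module.finrank (ZMod 2) V := by
  obtain ⟨L, hinv, hiso, hco⟩ := ps_pencil_split B Ys halt hsa hYalt hcomm hsq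
  exact ⟨L, hinv, hiso, hco, ps_lagrangian_finrank B hB halt L hiso hco⟩

end Summit.QuantumAdvantage.QuantumAdvantage.Theorems.CubicForrelation.NearExactIsExact
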